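import Summits.BirchSwinnertonDyer.BirchSwinnertonDyer.Theorems.CongruentShaFreeCutTwoAdicBDPTriple
import Summits.BirchSwinnertonDyer.BirchSwinnertonDyer.Theorems.CongruentShaFreeCutResidualCensus
import Summits.BirchSwinnertonDyer.BirchSwinnertonDyer.Theorems.CongruentShaFreeCutOfHeegnerNonTorsion
import Summits.BirchSwinnertonDyer.BirchSwinnertonDyer.Theorems.CongruentShaFreeCutDescentField
import Summits.BirchSwinnertonDyer.BirchSwinnertonDyer.Theorems.CongruentShaFreeCutRankPosSquarefreeReduction
import Summits.BirchSwinnertonDyer.BirchSwinnertonDyer.Theorems.CongruentShaFreeCutAssembly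
import Summits.BirchSwinnertonDyer.Rank1Residual.Partition.AnticyclotomicControlJSWEmbAt

set_option autoImplicit false

/-! # Route `CongruentShaFreeCut` (rung S2) — the WHOLE ROUTE in the v5 currency of record: crux A
(`RankPosOfTwoSelmerCorankOne`, stmt-19079, residual) ⟺ (res) at `2`, crux B and the leaf
`rankOne_twoConverse_congruentNumber` ⟸ {(res) at `2`, (LB-exist), (LB-wan), (LB-bdp)} + Poitou–Tate +
six refereed facts

Cell `bsd-cn100`; filed by the prover seat `bsd-cn100-s2b-c3` g3 as service for the S2 hands (the S2 twin of
`MordellShaFreeCutBDPTripleCensus`). Supports, does not close, stmt-BirchSwinnertonDyer-19079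
(`--supports … --as helper`). HONEST FRAMING: CONDITIONAL reductions only; nothing here proves crux A,
crux B, the leaf, the congruent number problem or any case of BSD. No research statement is restated:
(res) at `2` enters as the hypothesis `hres` spelled EXACTLY as the registered `stub_twoLocNonDegeneracy`
(line `heegner-field-links` v5 on 19079); the three BDP statements by their landed names
`CongruentShaFreeCutTwoAdicBDPTriple.{TwoAdicBDPElementExists, TwoAdicWanDivisibility, TwoAdicBDPValueAtOne}`
(line `two-adic-bdp-triple` v5b, p438932).

* `heegnerPoint_not_isOfFinAddOrder_of_corankLinkA_of_bdpTriple` — CORANK-currency plumbing at `p = 2`: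
  Link A in corank form (`TwoAdicControlOfCorankOne`) + the BDP triple ⟹ every Heegner point of level
  `N(E_n)` on `E_n` (`n` square-free) over a Heegner field with `2` split and `corank_{ℤ₂} Sel_{2^∞}(E_n/K)
  = 1` has infinite order (b2b's `X11b.Halves.two_mul_sub_one_le_valuation` with `a = 0`, THE embedding
  `embAt`, conjugate reading — the same algebra as the landed rank-currency plumbing p438932, no Kato);
* `cruxA_of_res_of_bdpTriple_of_poitouTate`, **`cruxA_iff_res_of_bdpTriple_of_poitouTate`** — crux A
  ⟸/⟺ (res) at `2` modulo the BDP triple + Poitou–Tate + {`2`-parity, modularity, Hoffstein–Luo, Kato,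
  Gross 1984} (Link A corank form = `CongruentShaFreeCutResidualCensus.twoAdicControlOfCorankOne_of_res`,
  p438194; `⟹` = p436277's fact-free `twoLocNonDegeneracy_of_cruxA`);
* **`leaf_of_res_of_bdpTriple_of_poitouTate`** — THE ROUTE'S KERNEL CENSUS: leaf ⟸ {(res) at `2`,
  (LB-exist), (LB-wan), (LB-bdp)} + Poitou–Tate + six refereed facts (`CongruentShaFreeCutAssembly.assembly_holds`).

[cite: Skinner2020, Thm. B and §2.2–2.3 (shape of (res))] [cite: CastellaGrossiLeeSkinner2022, §5.2 (proof of Thm. 5.2.1), Thm. 5.1.3]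
[cite: Castella2018, proof of Thm. 2.3 with Thm. 3.4 (arXiv:1704.06608 pp. 5, 10) (shape)]
[cite: MilneADT2006, Ch. I, Thm. 4.10(b)] [cite: GrossZagier1986, Thm. I.6.3 with V.§2] -/

noncomputable section

open scoped Classical

namespace Summit.BirchSwinnertonDyer.BirchSwinnertonDyer.Theorems.CongruentShaFreeCutBDPTripleCensus

open PowerSeries WeierstrassCurve NumberField IsDedekindDomain Field Literature.NumberTheory.EllipticCurves
  Literature.NumberTheory.EllipticCurves.ModularForms Literature.NumberTheory.QuadraticFields
  Literature.NumberTheory.EllipticCurves.Castella2018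
open Literature.NumberTheory.GaloisRepresentations Literature.NumberTheory.GaloisCohomology
open Summit.BirchSwinnertonDyer.BirchSwinnertonDyer.Theses.CongruentShaFreeCut
open Summit.BirchSwinnertonDyer.BirchSwinnertonDyer.Theorems.CongruentShaFreeCutTwoAdicBDPTriple
  (TwoAdicBDPElementExists TwoAdicWanDivisibility TwoAdicBDPValueAtOne
    stub_heegnerNonTorsion_of_linkA_of_bdpTriple)
open Summit.BirchSwinnertonDyer.BirchSwinnertonDyer.Theorems.CongruentShaFreeCutTwoAdicLinksCorank
  (TwoAdicControlOfCorankOne heegnerPointSupply_of_gross)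
open Summit.BirchSwinnertonDyer.BirchSwinnertonDyer.Theorems.CongruentShaFreeCutResidualCensus
  (twoAdicControlOfCorankOne_of_res)
open Summit.BirchSwinnertonDyer.BirchSwinnertonDyer.Theorems.CongruentShaFreeCutLocNonDegeneracy
  (twoLocNonDegeneracy_of_cruxA)
open Summit.BirchSwinnertonDyer.BirchSwinnertonDyer.Theorems.CongruentShaFreeCutOfHeegnerNonTorsion
  (HeegnerNonTorsionAtTwo analyticRankOne_of_facts_of_heegnerNonTorsion)

/-! ## 1. Corank-currency plumbing at `p = 2` -/

/-- **Link A in CORANK form + the BDP triple force every Heegner point on `E_n` to be non-torsion at a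
corank-one datum** (no Kato, no rank hypothesis): for square-free `n`, `K` imaginary quadratic with the
Heegner hypothesis for `N = N(E_n)` and for `2`, `corank_{ℤ₂} Sel_{2^∞}(E_n/K) = 1`, and a Heegner point `P`
of level `N`: `F(0) ≠ 0` (`hAc` at THE embedding `embAt K 2 v` of a degree-one `v ∣ 2`) ⟹ `𝓛(𝟙) ≠ 0`
((LB-exist), (LB-wan) along `X11b.Halves.toUnr 2`) ⟹ `log_ω(τ_* P) ≠ 0` ((LB-bdp) at the Galois-conjugate
reading, `X11b.Halves.two_mul_sub_one_le_valuation` with `a = 0`) ⟹ `P` not torsion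
(`AcPConverseLinks.padicLogPoint_formalIndex_smul_eq_zero_of_isOfFinAddOrder`). CONDITIONAL; credits nothing.
[cite: Castella2018, proof of Thm. 2.3 with Thm. 3.4 (arXiv:1704.06608 pp. 5, 10) (shape)]
[cite: CastellaGrossiLeeSkinner2022, §5.2 (proof of Thm. 5.2.1)] [cite: SilvermanAEC2009, IV.6.4 and VII.2.2] -/
theorem heegnerPoint_not_isOfFinAddOrder_of_corankLinkA_of_bdpTriple
    (hAc : TwoAdicControlOfCorankOne) (hE : TwoAdicBDPElementExists)
    (hWan : TwoAdicWanDivisibility) (hV : TwoAdicBDPValueAtOne) :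
    ∀ ⦃n : ℕ⦄, Squarefree n → ∀ (K : Type) [Field K] [NumberField K] (N : ℕ) [NeZero N],
      (congruentNumberCurve n).conductorNorm ℤ = N → IsImaginaryQuadratic K →
        SatisfiesHeegnerHypothesis N K → SatisfiesHeegnerHypothesis 2 K →
          ((congruentNumberCurve n).baseChange K).selmerCorank 2 = 1 →
            ∀ (P : ((congruentNumberCurve n).baseChange K).toAffine.Point),
              IsHeegnerPoint N (congruentNumberCurve n) K P → ¬ IsOfFinAddOrder P := by
  intro n hsq K _ _ N _ hN hK hHN hH2 hcK P hP hPtor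
  haveI : Fact (Nat.Prime 2) := ⟨Nat.prime_two⟩
  haveI := isElliptic_congruentNumberCurve hsq.ne_zero
  haveI := isGloballyMinimal_congruentNumberCurve hsq
  have hsplit : ((Ideal.span {(2 : ℤ)}).primesOver (𝓞 K)).ncard = 2 :=
    hH2 2 Nat.prime_two (dvd_refl 2)
  -- (1) the anticyclotomic datum, THE embedding at a degree-one `v ∣ 2`, the partner `v̄`
  obtain ⟨κ, γ, v, hκ, hγ, hv2, he, hf⟩ :=
    Summit.BirchSwinnertonDyer.Rank1Residual.X11b.exists_anticyclotomic_generator_degreeOnePrime 2 K hK hH2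
  haveI : Fact (κ.IsTopGenerator γ) := ⟨hγ⟩
  set ι : K →+* ℚ_[2] := Summit.BirchSwinnertonDyer.Rank1Residual.X11b.embAt K 2 v hv2 he hf with hιdef
  have hv : ∀ x : 𝓞 K, x ∈ v.asIdeal ↔ ‖ι (x : K)‖ < 1 :=
    Summit.BirchSwinnertonDyer.Rank1Residual.X11b.mem_asIdeal_iff_norm_embAt_lt_one v hv2 he hf
  obtain ⟨vbar, hvbar, hne⟩ :=
    Summit.BirchSwinnertonDyer.Rank1Residual.X11b.exists_other_prime hH2 v hv2
  -- (2) Link A (corank form): a generator `F` of `char_Λ 𝔛` with `F(0) ≠ 0`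
  obtain ⟨m, hm⟩ := hAc hsq K N hN hK hHN hH2 ι v vbar hv hvbar hne κ hκ γ hcK
  obtain ⟨-, F, hF, hF0, -⟩ := hm
  have hFmem : F ∈ AcSelmer.XAc.charIdeal ((congruentNumberCurve n).baseChange K) 2 κ vbar ∅ γ := by
    rw [hF]; exact Ideal.mem_span_singleton_self F
  -- (3) the Heegner point data; its Galois conjugate readable at an infinite place
  obtain ⟨Dt, H, ιK, hPK⟩ := hP
  obtain ⟨w₀⟩ := (inferInstance : Nonempty (InfinitePlace K))
  haveI : IsGalois ℚ K := by
    haveI : Algebra.IsQuadraticExtension ℚ K := ⟨hK.1⟩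
    infer_instance
  obtain ⟨σ, hσ⟩ := NumberField.ComplexEmbedding.exists_comp_symm_eq_of_comp_eq (k := ℚ)
    w₀.embedding ιK (by ext x; simp)
  set τ : K →+* K := ((σ.symm : K ≃ₐ[ℚ] K) : K →+* K) with hτdef
  set P' := WeierstrassCurve.Affine.Point.map τ.toRatAlgHom P with hP'def
  have hP' : WeierstrassCurve.Affine.Point.map w₀.embedding.toRatAlgHom P' =
      heegnerPointComplex Dt H := by
    rw [hP'def, WeierstrassCurve.Affine.Point.map_map]
    have hcomp : w₀.embedding.toRatAlgHom.comp τ.toRatAlgHom = ιK.toRatAlgHom := by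
      apply AlgHom.ext
      intro x
      have := RingHom.congr_fun hσ x
      simpa [hτdef] using this
    rw [hcomp]
    exact hPK
  have hP'tor : IsOfFinAddOrder P' := by
    rw [hP'def]; exact AddMonoidHom.isOfFinAddOrder _ hPtor
  -- (4) the BDP element and its embedding datum
  obtain ⟨ι', hι', ΩK, Ωp, L, hΩK, hBDP⟩ := hE hsq K N Dt v κ γ hN hK hHN hsplit hv2 hκ
  -- (5) (LB-wan) along `toUnr : ℤ₂ → R₀`
  obtain ⟨k, hk⟩ := hWan hsq ι' K N Dt v vbar κ γ hN hK hHN hsplit hι' hvbar hne hκ ΩK Ωp L hΩK hBDP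
    (Summit.BirchSwinnertonDyer.Rank1Residual.X11b.Halves.toUnr 2)
    (Summit.BirchSwinnertonDyer.Rank1Residual.X11b.Halves.coe_toUnr 2)
  set F' : IwasawaAlgebra 2 := C ((2 : ℤ_[2]) ^ k) * F with hF'def
  have hF'0 : constantCoeff F' ≠ 0 := by
    rw [hF'def, map_mul, PowerSeries.constantCoeff_C]
    exact mul_ne_zero (pow_ne_zero _ (by norm_num)) hF0
  have hfL : PowerSeries.map (Summit.BirchSwinnertonDyer.Rank1Residual.X11b.Halves.toUnr 2) F' ∈
      Ideal.span {L} := by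
    have hmap : PowerSeries.map (Summit.BirchSwinnertonDyer.Rank1Residual.X11b.Halves.toUnr 2) F' =
        C ((2 : unrIntegers 2) ^ k) *
          PowerSeries.map (Summit.BirchSwinnertonDyer.Rank1Residual.X11b.Halves.toUnr 2) F := by
      rw [hF'def, map_mul, PowerSeries.map_C, map_pow, map_ofNat]
    rw [hmap]
    exact hk F hFmem
  -- (6) (LB-bdp) at the conjugate reading `P'`
  obtain ⟨u, hu⟩ := hV hsq ι' K N Dt H w₀ ι v κ γ P' hN hK hHN hsplit hv2 hι' hκ hP' hv ΩK Ωp L hΩK hBDP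
  set x : ℚ_[2] := (Dt.c : ℚ_[2])⁻¹ *
      (1 - ((congruentNumberCurve n).LFunction 2 : ℚ_[2]) * (2 : ℚ_[2])⁻¹ +
        (if (2 : ℕ) ∣ N then 0 else (2 : ℚ_[2])⁻¹)) *
      padicLogOmega (congruentNumberCurve n) 2 ι P' with hxdef
  have hshape : ((Dt.c : ℚ_[2])⁻¹) ^ 2 *
      (1 - ((congruentNumberCurve n).LFunction 2 : ℚ_[2]) * (2 : ℚ_[2])⁻¹ +
        (if (2 : ℕ) ∣ N then 0 else (2 : ℚ_[2])⁻¹)) ^ 2 *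
      (padicLogOmega (congruentNumberCurve n) 2 ι P') ^ 2 =
      (((1 : ℚ_[2]) - ((0 : ℤ) : ℚ_[2]) * ((2 : ℕ) : ℚ_[2])⁻¹) * x) ^ 2 := by
    rw [hxdef]; push_cast; ring
  rw [hshape, map_pow] at hu
  -- (7) the algebra of halves: `x ≠ 0`, hence `log_ω P' ≠ 0`; a torsion point has zero logarithm
  obtain ⟨hx0, -⟩ :=
    Summit.BirchSwinnertonDyer.Rank1Residual.X11b.Halves.two_mul_sub_one_le_valuation 2 hF'0 hfL u 0 hu
  apply hx0
  rw [hxdef]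
  unfold padicLogOmega
  rw [AcPConverseLinks.padicLogPoint_formalIndex_smul_eq_zero_of_isOfFinAddOrder (congruentNumberCurve n) 2
    ι hP'tor, zero_div, mul_zero]

/-! ## 2. Crux A from (res) and the BDP triple -/

/-- **Crux A on square-free `n` from Link A in corank form and the BDP triple** (five refereed facts for
the descent field and the Heegner point): descend to the Heegner field
(`CongruentShaFreeCutDescentField.descentField_of_parity_of_hoffsteinLuo_of_kato`), take a Heegner point
(`heegnerPointSupply_of_gross`), apply the corank-currency plumbing, Mordell–Weil.
[cite: CastellaGrossiLeeSkinner2022, §5.2 (proof of Thm. 5.2.1)] -/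
theorem rankPos_squarefree_of_corankLinkA_of_bdpTriple
    (hpar : ∀ (W : WeierstrassCurve ℚ) [W.IsElliptic] (p : ℕ) [Fact p.Prime], p_parity W p)
    (hmod : ModularForms.exists_isNewformOf) (hHL : HoffsteinLuo1997_exists_twist_L_one_ne_zero)
    (hKato : ∀ (W : WeierstrassCurve ℚ) [W.IsElliptic] (p : ℕ) [Fact p.Prime],
      kato_finite_of_L_one_ne_zero W p)
    (hHP : ∀ (W : WeierstrassCurve ℚ) (K : Type) [Field K] [NumberField K],
      exists_isHeegnerPoint W K)
    (hAc : TwoAdicControlOfCorankOne) (hE : TwoAdicBDPElementExists)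
    (hWan : TwoAdicWanDivisibility) (hV : TwoAdicBDPValueAtOne) :
    ∀ ⦃n : ℕ⦄, Squarefree n → (congruentNumberCurve n).selmerCorank 2 = 1 →
      1 ≤ (congruentNumberCurve n).mordellWeilRank := by
  intro n hsq hc
  haveI := isElliptic_congruentNumberCurve hsq.ne_zero
  haveI := isGloballyMinimal_congruentNumberCurve hsq
  haveI : NeZero ((congruentNumberCurve n).conductorNorm ℤ) :=
    ⟨((congruentNumberCurve n).conductorNorm_pos_holds).ne'⟩
  obtain ⟨K, _, _, hK, hHN, hH2, hcK, hrk⟩ :=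
    CongruentShaFreeCutDescentField.descentField_of_parity_of_hoffsteinLuo_of_kato hpar hmod hHL hKato
      hsq.ne_zero hc
  obtain ⟨P, hP⟩ :=
    heegnerPointSupply_of_gross hHP hsq K ((congruentNumberCurve n).conductorNorm ℤ) rfl hK hHN
  have hPnt : ¬ IsOfFinAddOrder P :=
    heegnerPoint_not_isOfFinAddOrder_of_corankLinkA_of_bdpTriple hAc hE hWan hV hsq K
      ((congruentNumberCurve n).conductorNorm ℤ) rfl hK hHN hH2 hcK P hP
  have hrkK : 1 ≤ ((congruentNumberCurve n).baseChange K).mordellWeilRank :=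
    one_le_mordellWeilRank_of_not_isOfFinAddOrder _
      ((congruentNumberCurve n).baseChange K).module_finite_point_holds hPnt
  rwa [hrk] at hrkK

/-- **Crux A `RankPosOfTwoSelmerCorankOne` from (res) at `2`, the BDP triple, Poitou–Tate and five refereed
facts**: Link A in corank form is `twoAdicControlOfCorankOne_of_res hPT hres` (p438194: (res) + the landed
algebra `stub_selmerAcBaseFinite_of_resCorankOne` + tower control), then
`rankPos_squarefree_of_corankLinkA_of_bdpTriple` and the square-free reduction
`rankPosOfTwoSelmerCorankOne_of_squarefree` (p419178). CONDITIONAL; credits nothing.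
[cite: Skinner2020, Thm. B (shape)] [cite: CastellaGrossiLeeSkinner2022, §5.2 (proof of Thm. 5.2.1)] -/
theorem cruxA_of_res_of_bdpTriple_of_poitouTate
    (hpar : ∀ (W : WeierstrassCurve ℚ) [W.IsElliptic] (p : ℕ) [Fact p.Prime], p_parity W p)
    (hmod : ModularForms.exists_isNewformOf) (hHL : HoffsteinLuo1997_exists_twist_L_one_ne_zero)
    (hKato : ∀ (W : WeierstrassCurve ℚ) [W.IsElliptic] (p : ℕ) [Fact p.Prime],
      kato_finite_of_L_one_ne_zero W p)
    (hHP : ∀ (W : WeierstrassCurve ℚ) (K : Type) [Field K] [NumberField K],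
      exists_isHeegnerPoint W K)
    (hPT : ∀ (K : Type) [Field K] [NumberField K], poitouTate_sum_localTatePairing_eq_zero K)
    (hres : ∀ ⦃n : ℕ⦄, Squarefree n → ∀ (K : Type) [Field K] [NumberField K],
      IsImaginaryQuadratic K → SatisfiesHeegnerHypothesis 2 K →
        ((congruentNumberCurve n).baseChange K).selmerCorank 2 = 1 →
      ∀ (w : HeightOneSpectrum (𝓞 K)), ((2 : ℕ) : 𝓞 K) ∈ w.asIdeal →
        Finite ↥(((congruentNumberCurve n).baseChange K).selmerGroupPInfty 2 ⊓
          selmerLocalKerPrimaryTorsion ((congruentNumberCurve n).baseChange K) (w.adicCompletion K) 2))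
    (hE : TwoAdicBDPElementExists) (hWan : TwoAdicWanDivisibility) (hV : TwoAdicBDPValueAtOne) :
    RankPosOfTwoSelmerCorankOne :=
  CongruentShaFreeCutRankPosSquarefreeReduction.rankPosOfTwoSelmerCorankOne_of_squarefree
    (rankPos_squarefree_of_corankLinkA_of_bdpTriple hpar hmod hHL hKato hHP
      (twoAdicControlOfCorankOne_of_res hPT hres) hE hWan hV)

/-- **KERNEL CENSUS of the residual in the currency of record: modulo the BDP triple, Poitou–Tate and five
refereed facts, crux A `RankPosOfTwoSelmerCorankOne` ⟺ (res) at `2`** (the registered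
`stub_twoLocNonDegeneracy` statement): `⟸` is `cruxA_of_res_of_bdpTriple_of_poitouTate`, `⟹` the fact-free
`CongruentShaFreeCutLocNonDegeneracy.twoLocNonDegeneracy_of_cruxA` (p436277). CONDITIONAL; credits nothing.
[cite: Skinner2020, Thm. B and §2.2 (shape of (res))] [cite: WZhang2014, Thm. 1.3 and Remark 2 (p. 198)] -/
theorem cruxA_iff_res_of_bdpTriple_of_poitouTate
    (hpar : ∀ (W : WeierstrassCurve ℚ) [W.IsElliptic] (p : ℕ) [Fact p.Prime], p_parity W p)
    (hmod : ModularForms.exists_isNewformOf) (hHL : HoffsteinLuo1997_exists_twist_L_one_ne_zero)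
    (hKato : ∀ (W : WeierstrassCurve ℚ) [W.IsElliptic] (p : ℕ) [Fact p.Prime],
      kato_finite_of_L_one_ne_zero W p)
    (hHP : ∀ (W : WeierstrassCurve ℚ) (K : Type) [Field K] [NumberField K],
      exists_isHeegnerPoint W K)
    (hPT : ∀ (K : Type) [Field K] [NumberField K], poitouTate_sum_localTatePairing_eq_zero K)
    (hE : TwoAdicBDPElementExists) (hWan : TwoAdicWanDivisibility) (hV : TwoAdicBDPValueAtOne) :
    RankPosOfTwoSelmerCorankOne ↔
      ∀ ⦃n : ℕ⦄, Squarefree n → ∀ (K : Type) [Field K] [NumberField K],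
        IsImaginaryQuadratic K → SatisfiesHeegnerHypothesis 2 K →
          ((congruentNumberCurve n).baseChange K).selmerCorank 2 = 1 →
        ∀ (w : HeightOneSpectrum (𝓞 K)), ((2 : ℕ) : 𝓞 K) ∈ w.asIdeal →
          Finite ↥(((congruentNumberCurve n).baseChange K).selmerGroupPInfty 2 ⊓
            selmerLocalKerPrimaryTorsion ((congruentNumberCurve n).baseChange K) (w.adicCompletion K) 2) :=
  ⟨fun hA _ hn K _ _ hK hH2 hcK w hw ↦ twoLocNonDegeneracy_of_cruxA hA hn K hK hH2 hcK w hw,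
    fun hres ↦ cruxA_of_res_of_bdpTriple_of_poitouTate hpar hmod hHL hKato hHP hPT hres hE hWan hV⟩

/-! ## 3. The whole route -/

/-- **THE ROUTE'S KERNEL CENSUS (v5 currency of record): the rung-S2 leaf `rankOne_twoConverse_congruentNumber`
⟸ {(res) at `2`, (LB-exist), (LB-wan), (LB-bdp)} + Poitou–Tate + the six refereed facts** (`2`-parity,
modularity, Hoffstein–Luo, Kato, Gross 1984, Gross–Zagier + Kolyvagin): the route's Assembly
(`CongruentShaFreeCutAssembly.assembly_holds`) of `cruxA_of_res_of_bdpTriple_of_poitouTate` and crux B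
from the BDP triple (the landed plumbing `stub_heegnerNonTorsion_of_linkA_of_bdpTriple`, p438932, with Link A
:= `twoAdicControlOfRankOne_of_poitouTate hPT`, p432373, then `analyticRankOne_of_facts_of_heegnerNonTorsion`;
inlined — the S2 hand lands the named form). Research content of the route = ONE Selmer-only statement at the
additive prime `2` + ONE construction + ONE main-conjecture divisibility + ONE special-value formula; textbook
debt = Poitou–Tate. CONDITIONAL; neither BSD nor the congruent number problem is touched.
[cite: GrossZagier1986, Thm. I.6.3 with V.§2] [cite: CastellaGrossiLeeSkinner2022, §5.2 (proof of Thm. 5.2.1)]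
[cite: MilneADT2006, Ch. I, Thm. 4.10(b)] -/
theorem leaf_of_res_of_bdpTriple_of_poitouTate
    (hpar : ∀ (W : WeierstrassCurve ℚ) [W.IsElliptic] (p : ℕ) [Fact p.Prime], p_parity W p)
    (hmod : ModularForms.exists_isNewformOf) (hHL : HoffsteinLuo1997_exists_twist_L_one_ne_zero)
    (hKato : ∀ (W : WeierstrassCurve ℚ) [W.IsElliptic] (p : ℕ) [Fact p.Prime],
      kato_finite_of_L_one_ne_zero W p)
    (hHP : ∀ (W : WeierstrassCurve ℚ) (K : Type) [Field K] [NumberField K],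
      exists_isHeegnerPoint W K)
    (hGZ : ∀ (W : WeierstrassCurve ℚ) (N : ℕ) [NeZero N] (K : Type) [Field K] [NumberField K],
      analyticRankEK_eq_one_iff_heegner_nonTorsion W N K)
    (hPT : ∀ (K : Type) [Field K] [NumberField K], poitouTate_sum_localTatePairing_eq_zero K)
    (hres : ∀ ⦃n : ℕ⦄, Squarefree n → ∀ (K : Type) [Field K] [NumberField K],
      IsImaginaryQuadratic K → SatisfiesHeegnerHypothesis 2 K →
        ((congruentNumberCurve n).baseChange K).selmerCorank 2 = 1 →
      ∀ (w : HeightOneSpectrum (𝓞 K)), ((2 : ℕ) : 𝓞 K) ∈ w.asIdeal →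
        Finite ↥(((congruentNumberCurve n).baseChange K).selmerGroupPInfty 2 ⊓
          selmerLocalKerPrimaryTorsion ((congruentNumberCurve n).baseChange K) (w.adicCompletion K) 2))
    (hE : TwoAdicBDPElementExists) (hWan : TwoAdicWanDivisibility) (hV : TwoAdicBDPValueAtOne) :
    rankOne_twoConverse_congruentNumber :=
  CongruentShaFreeCutAssembly.assembly_holds
    (cruxA_of_res_of_bdpTriple_of_poitouTate hpar hmod hHL hKato hHP hPT hres hE hWan hV)
    -- crux B ⟸ BDP triple + PT + facts: the landed plumbing (p438932) ∘ Link A mod PT (p432373) ∘ the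
    -- v2 composition; inlined (the S2 hand lands the named form in `CongruentShaFreeCutTwoAdicBDPTriple`)
    (analyticRankOne_of_facts_of_heegnerNonTorsion hpar hmod hHL hKato hHP hGZ
      (stub_heegnerNonTorsion_of_linkA_of_bdpTriple hKato
        (CongruentShaFreeCutTwoAdicControlOfPoitouTate.twoAdicControlOfRankOne_of_poitouTate hPT)
        hE hWan hV))

end Summit.BirchSwinnertonDyer.BirchSwinnertonDyer.Theorems.CongruentShaFreeCutBDPTripleCensus

end
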